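/-
Copyright (c) 2026 the pub-hodgecm-mathlib formalisation cell (harness21).  Prover seat hodgecm-mathlib-B-p04 (g35), heir of the (R2) EP pen, 2026-09-01.
«EP-UNR-ALL»: the (R2) relations and Kottwitz's Euler–Poincaré function on `U(Φ₂)(L⁺_v)` at EVERY unramified non-split place (including `v ∣ 2`), HYPOTHESIS-FREE.
-/
import Literature.NumberTheory.Rogawski1990.RankOneEulerPoincareNonsplitUnramified        -- ★ B-p14 (g32) p843407: `exists_epRelations_of_ellipticRelation`, `…_of_ellipticRelation` (the glue at `K, K′, I`)
import Literature.NumberTheory.Automorphic.UnitaryTwoEulerPoincareEllipticInert            -- ★ B-p08 (g28) p843461: the type-blind tree instance `natCard_fixedBy_add_eq_natCard_fixedBy_add_one_of_finite`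
import Literature.NumberTheory.Automorphic.FixedCosetsFiniteOfCompactCentralizer          -- ★ B-p04 (g35) p843428: `finite_fixedBy_quotient_and_of_isClosed` (the three finiteness binders)
import Literature.NumberTheory.Automorphic.UnitaryUnitOrbitalIntegralFixedPoints          -- ★ `isClosed_conjClass_local_of_isRegularElt` (via `LocalRegularOrbitClosed`), the `U(H)(L⁺_v)` instances
import HarnessLib

/-!
# The Euler–Poincaré function on `U(Φ₂)(L⁺_v)` at EVERY unramified non-split place, hypothesis-free (the tree road; `v ∣ 2` included)

Topic `NumberTheory/Rogawski1990`, namespace `Literature.NumberTheory.Rogawski1990`.  THEOREMS ONLY: no definition, no named fact, no instance, no notation,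
no `sorry`; kernel lane.  Cell `pub/hodgecm-mathlib` (D-0151), crux H413 = `stmt-HodgeConjecture-24833`, line «N6nsGerm», stub `stub_N6nsR2EP :
RankOneEulerPoincareNonsplit` [Kottwitz1988 §2 Thm 2]; the EP pen's assembly «EP-UNR-ALL» (LEAD F0P3a-plan (g10) WORD T9-8 (C)).  HONEST LABEL: HC_CM is proved
only modulo the cell's remaining named inputs (hLiu418, h413) until rung 0 closes; (R2) is a printed theorem and this file discharges its body at every
UNRAMIFIED non-split place from in-tree facts — the twin ★ `RankOneEulerPoincareNonsplitUnramifiedOdd` (B-p14 (g32)) needs `2 ∈ 𝒪_w^×` because it goes through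
the type-(2) COUNT; here the elliptic relation (E) comes from the TREE (Kottwitz's fixed subtree is a finite tree: `#vertices = #edges + 1`), which is blind to the
torus type and to the residue characteristic.

THE MATHEMATICS.  `v` a finite place of `L⁺` non-split and unramified in the CM field `L`, `w ∣ v`, `ϖ` a `σ_w`-fixed uniformiser of `L_w`, `U₂ = U(Φ₂)(L⁺_v)`,
`K = U(Φ₂)(𝒪_v)`, `K′ = Ad_d K` (`d = diag(1, ϖ)`), `I = K ∩ K′`.  For a regular `γ ∈ U₂` with COMPACT centraliser: the conjugacy class of `γ` is closed (★
`isClosed_conjClass_local_of_isRegularElt`), so `Fix_γ(U₂⧸K)`, `Fix_γ(U₂⧸K′)` and the `⟨γ⟩`-orbit of the base coset are FINITE (★ B-p04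
`finite_fixedBy_quotient_and_of_isClosed`); the type-blind tree instance ★ B-p08 `natCard_fixedBy_add_eq_natCard_fixedBy_add_one_of_finite` (★ A-p17 (T3)∕(T4) on
`U(Φ₂)(L_w)` with (hA)(hB) ★ F0P2-p02, (hI) ★ B-p04) then gives (E) `#Fix(U₂⧸K) + #Fix(U₂⧸K′) = #Fix(U₂⧸I) + 1`; (N) and the function `f_EP = 𝟙_K∕ν(K) + 𝟙_{K′}∕ν(K′) −
𝟙_I∕ν(I)` are ★ B-p14's glue `…_of_ellipticRelation` (with ★ B-p10 `epNonEllipticRelation`).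

* §1 **`epEllipticRelation_of_unramified`** — (E) at `K, K′, I` for every regular elliptic `γ`, every unramified non-split `v` (the `hE` binder of ★
  `exists_epRelations_of_ellipticRelation` VERBATIM).
* §2 **`exists_epRelations_of_unramified`** — the per-place hypothesis of ★ `rankOneEulerPoincareNonsplit_of_relations` at `(L, v)`.
* §3 **`exists_isLocSmooth_classOrbitalIntegral_eq_one_zero_of_unramified`** — the BODY of ★ `RankOneEulerPoincareNonsplit` at `(L, v, ν, m)` for every
  unramified non-split `v` (supersedes-by-generalisation ★ `…_of_isUnit_two`).

## References
* [Kottwitz1988] R. E. Kottwitz, *Tamagawa numbers*, Ann. of Math. 127 (1988), 629–646, §2 Theorem 2 (Euler–Poincaré functions; `O_γ(f_EP) = χ(X^γ)`).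
* [Rogawski1990] J. D. Rogawski, *Automorphic Representations of Unitary Groups in Three Variables*, Ann. of Math. Stud. 123 (1990), §12.6 p. 174, §12.7 Lemma 12.7.1 p. 176.
* [Serre1980Trees] J.-P. Serre, *Trees* (1980), Ch. I §6.1, Ch. II §1.1 (fixed subtrees; the tree of a rank-one group).
-/

set_option autoImplicit false

noncomputable section

open scoped ValuativeRel Matrix MatrixGroups
open Matrix ValuativeRel NumberField IsDedekindDomain MulAction MeasureTheory Measure

namespace Literature.NumberTheory.Rogawski1990

open Literature.NumberTheory.Automorphic Literature.NumberTheory.Automorphic.UnitaryGroup Literature.NumberTheory.GaloisRepresentations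

section Unramified

variable (L : Type) [Field L] [NumberField L] [IsCMField L] {v : HeightOneSpectrum (𝓞 ↥(maximalRealSubfield L))}
  (w : PlacesOver L v) (hw : IsCMField.complexConj L • w.1 = w.1)
  (ϖ : (w.1.adicCompletion L)ˣ) (hϖ : Valued.v (ϖ : w.1.adicCompletion L) = WithZero.exp (-1 : ℤ))
  (hσϖ : galAdicCompletionMap (L := L) (IsCMField.complexConj L) hw (ϖ : w.1.adicCompletion L) = ϖ)

/-! ## §1 (E) at `K, K′, I` for every regular elliptic class, every unramified non-split `v` -/

include hw hϖ hσϖ in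
/-- **KOTTWITZ'S ELLIPTIC RELATION (E) AT `K, K′ := Ad_d K, I := K ⊓ K′`, for EVERY regular elliptic `γ ∈ U(Φ₂)(L⁺_v)`** at an unramified non-split `v`
(NO restriction on the residue characteristic, NO torus-type split): `#Fix(U₂⧸K, γ) + #Fix(U₂⧸K′, γ) = #Fix(U₂⧸I, γ) + 1` — the type-blind tree instance ★
`natCard_fixedBy_add_eq_natCard_fixedBy_add_one_of_finite` with its three finiteness binders discharged by ★ `finite_fixedBy_quotient_and_of_isClosed` (closed class ★
`isClosed_conjClass_local_of_isRegularElt`, compact centraliser, compact open levels ★ `isCompact_isOpen_cmLocalIntegralLevel` ∕ ★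
`isCompact_isOpen_map_cmDatumLocalNonsplitCongr_cmLocalIntegralLevel`). [cite: Kottwitz1988, §2 Theorem 2] [cite: Serre1980Trees, I.6.1, II.1.1] [cite: Rogawski1990, §12.6 p. 174] -/
theorem epEllipticRelation_of_unramified (hunr : Algebra.IsUnramifiedIn (𝓞 L) v.asIdeal)
    (γ : (cmDatum L 2 (Matrix.of fun i j : Fin 2 => if i.val + j.val + 1 = 2 then (1 : L) else 0)).Local v)
    (hreg : IsRegularElt (γ.val : GL (Fin 2) (UnitaryGroup.LocalRing L v)))
    (hc : CompactSpace (Subgroup.centralizer ({γ} : Set ((cmDatum L 2 (Matrix.of fun i j : Fin 2 => if i.val + j.val + 1 = 2 then (1 : L) else 0)).Local v)))) :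
    Nat.card (fixedBy ((cmDatum L 2 (Matrix.of fun i j : Fin 2 => if i.val + j.val + 1 = 2 then (1 : L) else 0)).Local v ⧸
          cmLocalIntegralLevel L 2 (Matrix.of fun i j : Fin 2 => if i.val + j.val + 1 = 2 then (1 : L) else 0) v) γ) +
        Nat.card (fixedBy ((cmDatum L 2 (Matrix.of fun i j : Fin 2 => if i.val + j.val + 1 = 2 then (1 : L) else 0)).Local v ⧸
          (cmLocalIntegralLevel L 2 (Matrix.of fun i j : Fin 2 => if i.val + j.val + 1 = 2 then (1 : L) else 0) v).map
            (cmDatumLocalNonsplitCongr L w hw (glDiagonal 2 (w.1.adicCompletion L) ![1, ϖ]) ϖ.isUnit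
              (formCongr_glDiagonal_eq_smul_two L w hw ϖ hσϖ)).toMulEquiv.toMonoidHom) γ) =
      Nat.card (fixedBy ((cmDatum L 2 (Matrix.of fun i j : Fin 2 => if i.val + j.val + 1 = 2 then (1 : L) else 0)).Local v ⧸
          (cmLocalIntegralLevel L 2 (Matrix.of fun i j : Fin 2 => if i.val + j.val + 1 = 2 then (1 : L) else 0) v ⊓
            (cmLocalIntegralLevel L 2 (Matrix.of fun i j : Fin 2 => if i.val + j.val + 1 = 2 then (1 : L) else 0) v).map
              (cmDatumLocalNonsplitCongr L w hw (glDiagonal 2 (w.1.adicCompletion L) ![1, ϖ]) ϖ.isUnit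
                (formCongr_glDiagonal_eq_smul_two L w hw ϖ hσϖ)).toMulEquiv.toMonoidHom)) γ) + 1 := by
  haveI := hc
  -- the class of a regular `γ` is closed; the two vertex levels are compact open
  have hO := isClosed_conjClass_local_of_isRegularElt L 2 (Matrix.of fun i j : Fin 2 => if i.val + j.val + 1 = 2 then (1 : L) else 0) v
    (antidiagOne_isHermitian L 2) (isUnit_antidiagOne_det L 2).ne_zero γ hreg
  obtain ⟨hKc, hKo⟩ := isCompact_isOpen_cmLocalIntegralLevel L 2 (Matrix.of fun i j : Fin 2 => if i.val + j.val + 1 = 2 then (1 : L) else 0) v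
  obtain ⟨hK'c, hK'o⟩ := isCompact_isOpen_map_cmDatumLocalNonsplitCongr_cmLocalIntegralLevel L w hw ϖ hσϖ
  -- the three finiteness binders of the tree instance
  obtain ⟨hKfin, hK'fin, horb⟩ := finite_fixedBy_quotient_and_of_isClosed γ hO _ _ hKo hKc hK'o hK'c
  exact natCard_fixedBy_add_eq_natCard_fixedBy_add_one_of_finite L v w hw hunr ϖ hϖ hσϖ _ _ _
    (fun g => mem_localIntegralLevel_iff_of_smul_eq (IsCMField.complexConj L) 2 _ (IsCMField.complexConj_ne_one L) w hw g)
    (mem_map_cmDatumLocalNonsplitCongr_cmLocalIntegralLevel_iff L w hw ϖ hσϖ) (fun _ => Subgroup.mem_inf) γ hKfin hK'fin horb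

/-! ## §2 The relations package at every unramified non-split `v` -/

variable
  [MeasurableSpace ((cmDatum L 2 (Matrix.of fun i j : Fin 2 => if i.val + j.val + 1 = 2 then (1 : L) else 0)).Local v)]
  [BorelSpace ((cmDatum L 2 (Matrix.of fun i j : Fin 2 => if i.val + j.val + 1 = 2 then (1 : L) else 0)).Local v)]
  [∀ γ : (cmDatum L 2 (Matrix.of fun i j : Fin 2 => if i.val + j.val + 1 = 2 then (1 : L) else 0)).Local v,
    MeasurableSpace (((cmDatum L 2 (Matrix.of fun i j : Fin 2 => if i.val + j.val + 1 = 2 then (1 : L) else 0)).Local v) ⧸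
      Subgroup.centralizer ({γ} : Set ((cmDatum L 2 (Matrix.of fun i j : Fin 2 => if i.val + j.val + 1 = 2 then (1 : L) else 0)).Local v)))]
  [∀ γ : (cmDatum L 2 (Matrix.of fun i j : Fin 2 => if i.val + j.val + 1 = 2 then (1 : L) else 0)).Local v,
    BorelSpace (((cmDatum L 2 (Matrix.of fun i j : Fin 2 => if i.val + j.val + 1 = 2 then (1 : L) else 0)).Local v) ⧸
      Subgroup.centralizer ({γ} : Set ((cmDatum L 2 (Matrix.of fun i j : Fin 2 => if i.val + j.val + 1 = 2 then (1 : L) else 0)).Local v)))]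
  (ν : Measure ((cmDatum L 2 (Matrix.of fun i j : Fin 2 => if i.val + j.val + 1 = 2 then (1 : L) else 0)).Local v))
  [IsHaarMeasure ν] [ν.IsMulRightInvariant]

include hw hϖ hσϖ in
/-- **THE (R2) RELATIONS PACKAGE AT EVERY UNRAMIFIED NON-SPLIT PLACE, HYPOTHESIS-FREE** — the per-place hypothesis of ★
`rankOneEulerPoincareNonsplit_of_relations` at `(L, v)`: `∃ K K′ I ≤ U(Φ₂)(L⁺_v)` compact open with (E) at every regular elliptic class and (N) at every
regular non-elliptic class (`K = U(Φ₂)(𝒪_v)`, `K′ = Ad_d K`, `I = K ⊓ K′`). [cite: Kottwitz1988, §2 Theorem 2] [cite: Rogawski1990, §12.6 p. 174] [cite: Serre1980Trees, II.1.1] -/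
theorem exists_epRelations_of_unramified (hunr : Algebra.IsUnramifiedIn (𝓞 L) v.asIdeal)
    {m : OrbitalMeasureFamily ((cmDatum L 2 (Matrix.of fun i j : Fin 2 => if i.val + j.val + 1 = 2 then (1 : L) else 0)).Local v)}
    (hm : m.IsCanonical (fun γ => IsRegularElt (γ.val : GL (Fin 2) (UnitaryGroup.LocalRing L v))) ν) :
    ∃ K K' I : Subgroup ((cmDatum L 2 (Matrix.of fun i j : Fin 2 => if i.val + j.val + 1 = 2 then (1 : L) else 0)).Local v),
      IsOpen (K : Set ((cmDatum L 2 (Matrix.of fun i j : Fin 2 => if i.val + j.val + 1 = 2 then (1 : L) else 0)).Local v)) ∧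
      IsCompact (K : Set ((cmDatum L 2 (Matrix.of fun i j : Fin 2 => if i.val + j.val + 1 = 2 then (1 : L) else 0)).Local v)) ∧
      IsOpen (K' : Set ((cmDatum L 2 (Matrix.of fun i j : Fin 2 => if i.val + j.val + 1 = 2 then (1 : L) else 0)).Local v)) ∧
      IsCompact (K' : Set ((cmDatum L 2 (Matrix.of fun i j : Fin 2 => if i.val + j.val + 1 = 2 then (1 : L) else 0)).Local v)) ∧
      IsOpen (I : Set ((cmDatum L 2 (Matrix.of fun i j : Fin 2 => if i.val + j.val + 1 = 2 then (1 : L) else 0)).Local v)) ∧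
      IsCompact (I : Set ((cmDatum L 2 (Matrix.of fun i j : Fin 2 => if i.val + j.val + 1 = 2 then (1 : L) else 0)).Local v)) ∧
      (∀ γ : (cmDatum L 2 (Matrix.of fun i j : Fin 2 => if i.val + j.val + 1 = 2 then (1 : L) else 0)).Local v,
        IsRegularElt (γ.val : GL (Fin 2) (UnitaryGroup.LocalRing L v)) →
        CompactSpace (Subgroup.centralizer
          ({γ} : Set ((cmDatum L 2 (Matrix.of fun i j : Fin 2 => if i.val + j.val + 1 = 2 then (1 : L) else 0)).Local v))) →
        Nat.card (fixedBy ((cmDatum L 2 (Matrix.of fun i j : Fin 2 => if i.val + j.val + 1 = 2 then (1 : L) else 0)).Local v ⧸ K) γ) +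
          Nat.card (fixedBy ((cmDatum L 2 (Matrix.of fun i j : Fin 2 => if i.val + j.val + 1 = 2 then (1 : L) else 0)).Local v ⧸ K') γ) =
          Nat.card (fixedBy ((cmDatum L 2 (Matrix.of fun i j : Fin 2 => if i.val + j.val + 1 = 2 then (1 : L) else 0)).Local v ⧸ I) γ) + 1) ∧
      (∀ γ : (cmDatum L 2 (Matrix.of fun i j : Fin 2 => if i.val + j.val + 1 = 2 then (1 : L) else 0)).Local v,
        IsRegularElt (γ.val : GL (Fin 2) (UnitaryGroup.LocalRing L v)) →
        ¬ CompactSpace (Subgroup.centralizer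
          ({γ} : Set ((cmDatum L 2 (Matrix.of fun i j : Fin 2 => if i.val + j.val + 1 = 2 then (1 : L) else 0)).Local v))) →
        (((ν K).toReal : ℂ))⁻¹ * classOrbitalIntegral m
            ((K : Set ((cmDatum L 2 (Matrix.of fun i j : Fin 2 => if i.val + j.val + 1 = 2 then (1 : L) else 0)).Local v)).indicator fun _ => (1 : ℂ))
            (ConjClasses.mk γ) +
          (((ν K').toReal : ℂ))⁻¹ * classOrbitalIntegral m
            ((K' : Set ((cmDatum L 2 (Matrix.of fun i j : Fin 2 => if i.val + j.val + 1 = 2 then (1 : L) else 0)).Local v)).indicator fun _ => (1 : ℂ))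
            (ConjClasses.mk γ) -
          (((ν I).toReal : ℂ))⁻¹ * classOrbitalIntegral m
            ((I : Set ((cmDatum L 2 (Matrix.of fun i j : Fin 2 => if i.val + j.val + 1 = 2 then (1 : L) else 0)).Local v)).indicator fun _ => (1 : ℂ))
            (ConjClasses.mk γ) = 0) :=
  exists_epRelations_of_ellipticRelation L w hw ϖ hϖ hσϖ ν hm (epEllipticRelation_of_unramified L w hw ϖ hϖ hσϖ hunr)

/-! ## §3 Kottwitz's Euler–Poincaré function at every unramified non-split `v` -/

include hw hϖ hσϖ in
/-- **KOTTWITZ'S EULER–POINCARÉ FUNCTION ON `U(Φ₂)(L⁺_v)` AT EVERY UNRAMIFIED NON-SPLIT PLACE, HYPOTHESIS-FREE**: for every two-sided Haar `ν` and every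
canonical orbital-measure family `m` there is a locally constant compactly supported `f` with `Φ(⟦γ⟧, f) = 1` at every regular elliptic class and `= 0` at every
regular non-elliptic class — THE BODY OF THE LETTER ★ `RankOneEulerPoincareNonsplit` at `(L, v, ν, m)`, `v ∣ 2` included (the `σ_w`-fixed uniformiser `ϖ` only
parametrises the proof). [cite: Kottwitz1988, §2 Theorem 2] [cite: Rogawski1990, §12.6 p. 174; §12.7 Lemma 12.7.1 p. 176] -/
theorem exists_isLocSmooth_classOrbitalIntegral_eq_one_zero_of_unramified (hunr : Algebra.IsUnramifiedIn (𝓞 L) v.asIdeal)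
    {m : OrbitalMeasureFamily ((cmDatum L 2 (Matrix.of fun i j : Fin 2 => if i.val + j.val + 1 = 2 then (1 : L) else 0)).Local v)}
    (hm : m.IsCanonical (fun γ => IsRegularElt (γ.val : GL (Fin 2) (UnitaryGroup.LocalRing L v))) ν) :
    ∃ f : (cmDatum L 2 (Matrix.of fun i j : Fin 2 => if i.val + j.val + 1 = 2 then (1 : L) else 0)).Local v → ℂ, IsLocSmooth f ∧
      (∀ γ : (cmDatum L 2 (Matrix.of fun i j : Fin 2 => if i.val + j.val + 1 = 2 then (1 : L) else 0)).Local v,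
          IsRegularElt (γ.val : GL (Fin 2) (UnitaryGroup.LocalRing L v)) →
          CompactSpace (Subgroup.centralizer ({γ} : Set ((cmDatum L 2 (Matrix.of fun i j : Fin 2 => if i.val + j.val + 1 = 2 then (1 : L) else 0)).Local v))) →
          classOrbitalIntegral m f (ConjClasses.mk γ) = 1) ∧
      (∀ γ : (cmDatum L 2 (Matrix.of fun i j : Fin 2 => if i.val + j.val + 1 = 2 then (1 : L) else 0)).Local v,
          IsRegularElt (γ.val : GL (Fin 2) (UnitaryGroup.LocalRing L v)) →
          ¬ CompactSpace (Subgroup.centralizer ({γ} : Set ((cmDatum L 2 (Matrix.of fun i j : Fin 2 => if i.val + j.val + 1 = 2 then (1 : L) else 0)).Local v))) →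
          classOrbitalIntegral m f (ConjClasses.mk γ) = 0) :=
  exists_isLocSmooth_classOrbitalIntegral_eq_one_zero_of_ellipticRelation L w hw ϖ hϖ hσϖ ν hm
    (epEllipticRelation_of_unramified L w hw ϖ hϖ hσϖ hunr)

end Unramified

end Literature.NumberTheory.Rogawski1990

end
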